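import Mathlib

/-!
# PneNP / ExpanderLinearGenerators — substitution barriers for the expansion-scale law, I:
# the cover lemma and the image-distance barrier (stmt-PneNP-11442, supports)

Route `PneNP/ExpanderLinearGenerators`, crux stmt-PneNP-11442
(`Summit.PneNP.PneNP.Theses.ExpanderLinearGenerators.ExpansionForcesDepthFregeSize`): depth-`d`
Frege lower bounds `2^{r^ε}` for unsolvable `ℓ`-sparse `(r, 3ℓ/4)`-boundary-expanding XOR
systems. Every lower bound of this kind in print — Ben-Sasson 2002, Håstad 2017/2020,
Galesi–Itsykson–Riazanov–Sofronova 2019/2023, and the tree's unconditional column-weight-two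
theorem `expansionForcesDepthFregeSize_of_colWeight_le_two` — is obtained by an AFFINE
SUBSTITUTION `x ↦ M y + c` from a graph Tseitin formula `B y = ch` (`B` the incidence matrix of a
connected graph `H`, `𝟙ᵀ ch = 1`) into the target system `A x = b`, in CONSEQUENCE FORM: every
substituted row of the target is an `𝔽₂`-sum of Tseitin axioms over a vertex set `W_i` of
bounded size `≤ w` (the rows of a matrix `P`), i.e.

  `A M = P B` and `b + A c = P ch`.                                                   (CF)

This file and its sibling `…SubstitutionBarriersPotential` prove, as pure linear algebra over
`ZMod 2`, the two obstructions recorded in the item's evidence memo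
`memo-11442-s17-substitution-barriers.md`, which together show that the substitution technique is
blind to the generic column-weight-`≥ 3` instance of the crux (two-sided expanders, and the
overdetermined systems of Krajíček's Problem 19.4.5 / stmt-PneNP-11443). Here:

* `SubstitutionBarrier.cover` — under (CF), if `A x = b` is unsolvable then every vertex of `H`
  lies in some `W_i` (else the substituted system would be satisfiable).
* `SubstitutionBarrier.imageDistance_card_mul_le` — **barrier I**: if every nonzero vector of
  the column space `Im A` has weight `≥ D`, then `|V(H)| · D ≤ w · (2 m w + D)` (`m` = number of
  rows). For overdetermined systems (`Im A` a good code, `D = Θ(m)`) only graphs with `O(w²)`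
  vertices embed at all, whatever the depth, the exponent or the routing.

The graph enters only through algebraic properties of `B` satisfied by the incidence matrix of
every connected graph: `B z = e_u + e_v` is solvable (paths) and "Tseitin minus one vertex is
solvable" (peel a spanning tree).

References: J. Krajíček, *Proof complexity* (CUP 2019), §13.4, §15.4, Problem 19.4.5;
E. Ben-Sasson, Comput. Complexity 11 (2002); N. Galesi, D. Itsykson, A. Riazanov, A. Sofronova,
APAL 174 (2023).
-/

namespace Summit.PneNP.PneNP.Theorems

set_option linter.dupNamespace false -- `Summit.PneNP.PneNP.…`: summit = sub-problem (D-0017)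

open Finset Matrix

namespace SubstitutionBarrier

variable {ι κ V Eh : Type*}


/-! ### Two counting helpers -/

/-- The weight (support size) of a vector over `ZMod 2`, written as a filter cardinality, is
subadditive. -/
theorem card_support_add_le [Fintype ι] [DecidableEq ι] (v v' : ι → ZMod 2) :
    (univ.filter fun i => (v + v') i ≠ 0).card ≤
      (univ.filter fun i => v i ≠ 0).card + (univ.filter fun i => v' i ≠ 0).card := by
  calc (univ.filter fun i => (v + v') i ≠ 0).card
      ≤ ((univ.filter fun i => v i ≠ 0) ∪ (univ.filter fun i => v' i ≠ 0)).card := by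
        refine card_le_card ?_
        intro i hi
        simp only [mem_filter, mem_univ, true_and, Pi.add_apply] at hi
        simp only [mem_union, mem_filter, mem_univ, true_and]
        by_contra h
        push Not at h
        exact hi (by rw [h.1, h.2, add_zero])
    _ ≤ _ := card_union_le _ _

/-- Extracting a column: `(P *ᵥ e_u) i = P i u`. -/
theorem mulVec_single_one [Fintype V] [DecidableEq V] (P : Matrix ι V (ZMod 2)) (u : V)
    (i : ι) :
    (P *ᵥ Pi.single u 1) i = P i u := by
  simp [Matrix.mulVec, dotProduct, Pi.single_apply]

/-! ### The cover lemma -/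

/-- **Cover lemma.** Under the consequence form `A M = P B`, `b + A c = P ch`, if the target
system `A x = b` is unsolvable and the Tseitin system `B y = ch` minus any single vertex `u` is
solvable, then every vertex `u` lies in the support of some row of `P` (i.e. in some `W_i`):
otherwise a solution of "Tseitin minus `u`" would pull back to a solution of the target. -/
theorem cover [Fintype κ] [Fintype V] [DecidableEq V] [Fintype Eh]
    (A : Matrix ι κ (ZMod 2)) (b : ι → ZMod 2) (c : κ → ZMod 2)
    (B : Matrix V Eh (ZMod 2)) (ch : V → ZMod 2) (P : Matrix ι V (ZMod 2))
    (M : Matrix κ Eh (ZMod 2))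
    (hE : ∀ x, A *ᵥ x ≠ b)
    (hsat : ∀ u : V, ∃ y : Eh → ZMod 2, ∀ v, v ≠ u → (B *ᵥ y) v = ch v)
    (hCF1 : A * M = P * B) (hCF2 : b + A *ᵥ c = P *ᵥ ch) (u : V) :
    ∃ i, P i u ≠ 0 := by
  by_contra hnone
  push Not at hnone
  obtain ⟨y, hy⟩ := hsat u
  apply hE (M *ᵥ y + c)
  have hPB : P *ᵥ (B *ᵥ y) = P *ᵥ ch := by
    funext i
    simp only [Matrix.mulVec, dotProduct]
    refine Finset.sum_congr rfl fun v _ => ?_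
    by_cases hv : v = u
    · subst hv; simp [hnone i]
    · simp only [Matrix.mulVec, dotProduct] at hy
      rw [hy v hv]
  calc A *ᵥ (M *ᵥ y + c) = (A * M) *ᵥ y + A *ᵥ c := by
        rw [Matrix.mulVec_add, Matrix.mulVec_mulVec]
    _ = P *ᵥ (B *ᵥ y) + A *ᵥ c := by rw [hCF1, ← Matrix.mulVec_mulVec]
    _ = (b + A *ᵥ c) + A *ᵥ c := by rw [hPB, hCF2]
    _ = b := by
        have hcc : A *ᵥ c + A *ᵥ c = 0 := funext fun a => CharTwo.add_self_eq_zero _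
        rw [add_assoc, hcc, add_zero]

/-! ### Barrier I: image distance -/

/-- **Barrier I (image-distance barrier).** In the consequence form `A M = P B`,
`b + A c = P ch` for an unsolvable target `A x = b` (rows indexed by `ι`, `m = |ι|`), with every
row of `P` supported on at most `w` vertices, with `B` the incidence-type matrix of a "connected"
structure (`B z = e_u + e_v` solvable for all `u, v`; Tseitin minus a vertex solvable), and with
every nonzero vector of the column space of `A` of weight at least `D`:
`|V| · D ≤ w · (2 m w + D)`. Proof: all columns `p_u` of `P` are nonzero (cover lemma), a column
value determines a class of at most `w` vertices, distinct values differ by a nonzero image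
vector (weight `≥ D`, so at most one value is lighter than `D/2`), and `Σ_u |p_u| ≤ m w`. -/
theorem imageDistance_card_mul_le [Fintype ι] [DecidableEq ι] [Fintype κ] [Fintype V]
    [DecidableEq V] [Fintype Eh]
    (A : Matrix ι κ (ZMod 2)) (b : ι → ZMod 2) (c : κ → ZMod 2)
    (B : Matrix V Eh (ZMod 2)) (ch : V → ZMod 2) (P : Matrix ι V (ZMod 2))
    (M : Matrix κ Eh (ZMod 2)) (w D : ℕ)
    (hE : ∀ x, A *ᵥ x ≠ b)
    (hsat : ∀ u : V, ∃ y : Eh → ZMod 2, ∀ v, v ≠ u → (B *ᵥ y) v = ch v)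
    (hjoin : ∀ u v : V, ∃ z : Eh → ZMod 2, B *ᵥ z = Pi.single u 1 + Pi.single v 1)
    (hD : ∀ x : κ → ZMod 2, A *ᵥ x ≠ 0 → D ≤ (univ.filter fun i => (A *ᵥ x) i ≠ 0).card)
    (hCF1 : A * M = P * B) (hCF2 : b + A *ᵥ c = P *ᵥ ch)
    (hW : ∀ i, (univ.filter fun u => P i u ≠ 0).card ≤ w) :
    Fintype.card V * D ≤ w * (2 * Fintype.card ι * w + D) := by
  classical
  -- columns of `P`, their weights, the set of distinct column values
  set p : V → ι → ZMod 2 := fun u i => P i u with hp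
  set wt : (ι → ZMod 2) → ℕ := fun v => (univ.filter fun i => v i ≠ 0).card with hwt
  set S : Finset (ι → ZMod 2) := univ.image p with hS
  -- (a) cover: every column is nonzero, hence every class has ≤ w members
  have hcov : ∀ u, ∃ i, P i u ≠ 0 := cover A b c B ch P M hE hsat hCF1 hCF2
  have hclass : ∀ val ∈ S, (univ.filter fun v => p v = val).card ≤ w := by
    intro val hval
    obtain ⟨u, -, rfl⟩ := mem_image.mp hval
    obtain ⟨i, hi⟩ := hcov u
    refine le_trans (card_le_card ?_) (hW i)
    intro v hv
    simp only [mem_filter, mem_univ, true_and] at hv ⊢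
    have : p v i = p u i := by rw [hv]
    simp only [hp] at this
    rwa [this]
  -- |V| ≤ |S| * w
  have hV : Fintype.card V ≤ S.card * w := by
    have h1 : (univ : Finset V).card = ∑ val ∈ S, (univ.filter fun v => p v = val).card :=
      card_eq_sum_card_fiberwise fun v _ => mem_image_of_mem p (mem_univ v)
    rw [← Finset.card_univ, h1]
    simpa [smul_eq_mul] using Finset.sum_le_card_nsmul S _ w hclass
  -- (c) distinct values differ by an image vector of weight ≥ D
  have hdiff : ∀ u v, p u ≠ p v → D ≤ wt (p u) + wt (p v) := by
    intro u v huv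
    obtain ⟨z, hz⟩ := hjoin u v
    have himg : A *ᵥ (M *ᵥ z) = p u + p v := by
      rw [Matrix.mulVec_mulVec, hCF1, ← Matrix.mulVec_mulVec, hz, Matrix.mulVec_add]
      funext i
      simp [hp, Pi.add_apply]
    have hne : A *ᵥ (M *ᵥ z) ≠ 0 := by
      rw [himg]
      intro h0
      apply huv
      have hvv : p v + p v = 0 := funext fun a => CharTwo.add_self_eq_zero _
      have := congrArg (fun q => q + p v) h0
      simpa [add_assoc, hvv] using this
    calc D ≤ wt (A *ᵥ (M *ᵥ z)) := hD _ hne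
      _ = wt (p u + p v) := by rw [himg]
      _ ≤ wt (p u) + wt (p v) := card_support_add_le _ _
  -- at most one light value
  have hlight : (S.filter fun val => 2 * wt val < D).card ≤ 1 := by
    refine Finset.card_le_one.mpr ?_
    intro a ha a' ha'
    simp only [mem_filter] at ha ha'
    obtain ⟨u, -, rfl⟩ := mem_image.mp ha.1
    obtain ⟨v, -, rfl⟩ := mem_image.mp ha'.1
    by_contra hne
    have := hdiff u v hne
    omega
  -- Σ_u wt (p u) ≤ m * w  (double counting the support of P)
  have hsumwt : ∑ u, wt (p u) ≤ Fintype.card ι * w := by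
    have h1 : ∑ u, wt (p u) = ∑ i : ι, (univ.filter fun u => P i u ≠ 0).card := by
      simp only [hwt, hp]
      simp only [Finset.card_filter]
      exact Finset.sum_comm
    rw [h1]
    have h2 := Finset.sum_le_card_nsmul univ (fun i => (univ.filter fun u => P i u ≠ 0).card) w
      fun i _ => hW i
    rw [smul_eq_mul, Finset.card_univ] at h2
    exact h2
  -- Σ_u wt (p u) ≥ Σ_{val ∈ S} wt val ≥ Σ_{heavy} wt val, and 2·(that) ≥ (#heavy)·D
  have hfiber : ∑ val ∈ S, wt val ≤ ∑ u, wt (p u) := by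
    have hcomp : ∑ u, wt (p u) = ∑ val ∈ S, (univ.filter fun v => p v = val).card • wt val := by
      rw [hS, Finset.sum_comp]
    rw [hcomp]
    refine Finset.sum_le_sum fun val hval => ?_
    obtain ⟨u, -, rfl⟩ := mem_image.mp hval
    have hpos : 0 < (univ.filter fun v => p v = p u).card :=
      card_pos.mpr ⟨u, by simp⟩
    rw [smul_eq_mul]
    exact Nat.le_mul_of_pos_left _ hpos
  have hheavy : (S.filter fun val => ¬ 2 * wt val < D).card * D ≤
      2 * ∑ val ∈ S.filter (fun val => ¬ 2 * wt val < D), wt val := by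
    rw [Finset.mul_sum]
    simpa [smul_eq_mul] using
      Finset.card_nsmul_le_sum (S.filter fun val => ¬ 2 * wt val < D) (fun val => 2 * wt val) D
        (fun val hval => by simp only [mem_filter, not_lt] at hval; exact hval.2)
  have hheavy_le : ∑ val ∈ S.filter (fun val => ¬ 2 * wt val < D), wt val ≤ ∑ val ∈ S, wt val :=
    Finset.sum_le_sum_of_subset_of_nonneg (filter_subset _ _) fun _ _ _ => Nat.zero_le _
  have hsplit : (S.filter fun val => 2 * wt val < D).card +
      (S.filter fun val => ¬ 2 * wt val < D).card = S.card :=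
    Finset.card_filter_add_card_filter_not _
  -- combine: (|S| - 1) * D ≤ 2 m w, hence |S| * D ≤ 2 m w + D, hence the claim
  have hSD : S.card * D ≤ 2 * Fintype.card ι * w + D := by
    have h22 : 2 * Fintype.card ι * w = 2 * (Fintype.card ι * w) := by ring
    rw [h22]
    have h2 : (S.filter fun val => ¬ 2 * wt val < D).card * D ≤ 2 * (Fintype.card ι * w) := by
      calc (S.filter fun val => ¬ 2 * wt val < D).card * D
          ≤ 2 * ∑ val ∈ S.filter (fun val => ¬ 2 * wt val < D), wt val := hheavy
        _ ≤ 2 * ∑ u, wt (p u) := by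
            have := le_trans hheavy_le hfiber; omega
        _ ≤ 2 * (Fintype.card ι * w) := by omega
    have h3 : S.card * D ≤ (S.filter fun val => 2 * wt val < D).card * D +
        (S.filter fun val => ¬ 2 * wt val < D).card * D := by
      rw [← add_mul, hsplit]
    have h4 : (S.filter fun val => 2 * wt val < D).card * D ≤ D := by
      calc (S.filter fun val => 2 * wt val < D).card * D ≤ 1 * D :=
            Nat.mul_le_mul_right _ hlight
        _ = D := one_mul _
    omega
  calc Fintype.card V * D ≤ (S.card * w) * D := Nat.mul_le_mul_right _ hV
    _ = w * (S.card * D) := by ring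
    _ ≤ w * (2 * Fintype.card ι * w + D) := Nat.mul_le_mul_left _ hSD

end SubstitutionBarrier

end Summit.PneNP.PneNP.Theorems
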